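import Summits.PneNP.PneNP.Theorems.SymmetryBudgetNoHiddenOrderWindowReadout
import Literature.Combinatorics.SimpleGraph.OrderedRefinementEquiv

/-!
# `NoHiddenOrder` (stmt-PneNP-14781), (R2c) function level: bridges between the `Fin m`-indexed root module and the window type `↥W`

Route `PneNP/SymmetryBudget`; continues `…WindowReadout.lean`.  The compiler's root module (`ReplayRoot`, `…ReplayRootDefs.lean`) is written over
owners `Fin m` with the window `W` as membership wires, while the per-label modules index everything by a vertex TYPE `V` with `Fintype.card V = n`
small — naturally `V := ↥W`.  Three bridges make the two fit without rebuilding either side: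

* `keyRank_univ_subtype` — a competition rank over the owners `↥S` (all of them) is the rank over `S` of the underlying index; hence
  `vecCmp_rankIn_subtype_eq`: a `VecCmp` over owners `↥W` on the signature wires computes, at `u : ↥W`, the `Fin m`-level raw-signature rank of `u.1`
  inside `W`;
* **`hsig_rankIn_subtype`** — for such a gadget the colouring `u ↦ C.rankIn x univ u` of `↥W` satisfies the hypothesis `hsig₀` of
  `GraphReadout.window_sound_subtype` (equal rank ⇒ equal adjacency to every ordered vertex); `hsig_rankIn_owners` is the owner-generic form;
* **`refineIn_comap_subtype`** — refinement inside the block commutes with passing to the window type: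
  `refineIn (G.comap Subtype.val) univ (c ∘ Subtype.val) u = refineIn G A c u.1` (`u : ↥A`), by the isomorphism-invariance of ordered colour
  refinement (`ocrIter_equiv`) along `↥(univ : Finset ↥A) ≃ ↥A`; so the root colouring `refineIn (rootGraph x) W c₀` read on `W` IS the start
  colouring `refineIn ((rootGraph x).comap Subtype.val) univ (c₀ ∘ Subtype.val)` of the process on `↥W`.
Sorry-free; supports stmt-PneNP-14781, does not close it.
-/

set_option linter.dupNamespace false -- `Summit.PneNP.PneNP.…` (D-0017 single-conjunct layout)

namespace Summit.PneNP.PneNP.Theorems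

open Finset Literature.Computability.Complexity Literature.Computability.Complexity.SymProg
open Literature.Combinatorics.SimpleGraph (ocrIter ocrIter_equiv)

namespace GraphReadout

/-! ### Ranks over the owners `↥S` -/

section Owners

variable {α β : Type*} [LinearOrder β]

/-- **A competition rank over all owners of the subtype `↥S` is the rank over `S`.** [folklore] -/
theorem keyRank_univ_subtype (S : Finset α) (f : α → β) (u : ↥S) :
    keyRank (univ : Finset ↥S) (f ∘ Subtype.val) u = keyRank S f u.1 := by
  unfold keyRank
  rw [← card_map (Function.Embedding.subtype _)]
  congr 1
  ext v
  simp only [mem_map, mem_filter, mem_univ, true_and, Function.Embedding.coe_subtype, Function.comp_apply, Subtype.exists,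
    exists_and_left, exists_prop, exists_eq_right_right]
  tauto

end Owners

section Sig

variable {m : ℕ} {W : Finset (Fin m)} {x : Fin m × Fin m → Bool}

/-- For a `VecCmp` gadget over ANY owner type whose vectors are the signature wires of `ι k`, the compared vectors are the raw signatures. [folklore] -/
theorem vecCmp_B_eq_rawSig_owners {Λ K : Type*} [DecidableEq Λ] {P : SymProg (Fin m × Fin m) Λ} (C : P.VecCmp K (m + m)) (ι : K → Fin m)
    {ff : Λ} (hff : P.sem x ff = false) (hb : ∀ k j, C.b k j = sigWire W (Sum.inr ff) (ι k) j) (k : K) : C.B x k = rawSig W x (ι k) := by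
  funext j
  show wval x (P.sem x) (C.b k j) = _
  rw [hb, wval_sigWire _ hff]

/-- **`hsig` for ranks over any owners**: equal `rankIn` of two owners inside `S` ⇒ their vertices have equal adjacency to every ordered vertex. [folklore] -/
theorem hsig_rankIn_owners {Λ K : Type*} [DecidableEq Λ] [DecidableEq K] {P : SymProg (Fin m × Fin m) Λ} (C : P.VecCmp K (m + m)) (ι : K → Fin m)
    (hι : ∀ k, ι k ∈ W) {ff : Λ} (hff : P.sem x ff = false) (hb : ∀ k j, C.b k j = sigWire W (Sum.inr ff) (ι k) j) {S : Finset K} {k k' : K}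
    (hk : k ∈ S) (hk' : k' ∈ S) (h : C.rankIn x S k = C.rankIn x S k') (i : Fin m) (hi : i ∉ W) :
    (rootGraph x).Adj i (ι k) ↔ (rootGraph x).Adj i (ι k') := by
  have hB : C.B x k = C.B x k' := (C.rankIn_eq_iff x hk hk').1 h
  rw [vecCmp_B_eq_rawSig_owners C ι hff hb, vecCmp_B_eq_rawSig_owners C ι hff hb] at hB
  exact rootGraph_adj_iff_of_rawSig_eq (hι k) (hι k') hB i hi

/-- A `VecCmp` over the owners `↥W` on the signature wires computes the `Fin m`-level raw-signature rank inside `W`. [folklore] -/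
theorem vecCmp_rankIn_subtype_eq {Λ : Type*} [DecidableEq Λ] {P : SymProg (Fin m × Fin m) Λ} (C : P.VecCmp ↥W (m + m)) {ff : Λ}
    (hff : P.sem x ff = false) (hb : ∀ (u : ↥W) j, C.b u j = sigWire W (Sum.inr ff) u.1 j) (u : ↥W) :
    C.rankIn x univ u = keyRank W (fun k => toLex (rawSig W x k)) u.1 := by
  rw [← keyRank_univ_subtype]
  unfold VecCmp.rankIn keyRank
  simp only [vecCmp_B_eq_rawSig_owners C Subtype.val hff hb, Function.comp_apply]

/-- **`hsig₀` of `window_sound_subtype` for the rank colouring of a `VecCmp` over the owners `↥W` on the signature wires.** [folklore] -/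
theorem hsig_rankIn_subtype {Λ : Type*} [DecidableEq Λ] {P : SymProg (Fin m × Fin m) Λ} (C : P.VecCmp ↥W (m + m)) {ff : Λ}
    (hff : P.sem x ff = false) (hb : ∀ (u : ↥W) j, C.b u j = sigWire W (Sum.inr ff) u.1 j) :
    ∀ u v : ↥W, C.rankIn x univ u = C.rankIn x univ v → ∀ i, i ∉ W → ((rootGraph x).Adj i u ↔ (rootGraph x).Adj i v) :=
  fun u v h i hi => hsig_rankIn_owners C Subtype.val (fun k => k.2) hff hb (mem_univ u) (mem_univ v) h i hi

/-- Ranks over the owners `↥W` are `< |W|` (colours the bit valuation of width `|W|` can hold). [folklore] -/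
theorem vecCmp_rankIn_subtype_lt {Λ : Type*} [DecidableEq Λ] {P : SymProg (Fin m × Fin m) Λ} (C : P.VecCmp ↥W (m + m)) (u : ↥W) :
    C.rankIn x univ u < Fintype.card ↥W := by
  unfold VecCmp.rankIn
  rw [← card_univ]
  exact card_lt_card ((filter_ssubset).2 ⟨u, mem_univ u, lt_irrefl _⟩)

end Sig

end GraphReadout

/-! ### Refinement inside a block commutes with passing to the window type -/

namespace BranchSum

variable {V : Type*} [DecidableEq V] (G : SimpleGraph V) [DecidableRel G.Adj]

/-- **`refineIn` on the window type is `refineIn` inside the block**: for `u : ↥A`,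
`refineIn (G.comap Subtype.val) univ (c ∘ Subtype.val) u = refineIn G A c u.1`. -/
theorem refineIn_comap_subtype (A : Finset V) (c : V → ℕ) (u : ↥A) :
    refineIn (G.comap Subtype.val) (univ : Finset ↥A) (c ∘ Subtype.val) u = refineIn G A c u.1 := by
  rw [refineIn_apply (c ∘ Subtype.val) (mem_univ u), refineIn_apply c u.2]
  -- the two induced subgraphs are isomorphic along `↥(univ : Finset ↥A) ≃ ↥A`
  let e : ↥((univ : Finset ↥A) : Set ↥A) ≃ ↥((A : Finset V) : Set V) :=
    { toFun := fun w => ⟨w.1.1, mem_coe.2 w.1.2⟩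
      invFun := fun v => ⟨⟨v.1, mem_coe.1 v.2⟩, mem_coe.2 (mem_univ _)⟩
      left_inv := fun w => rfl
      right_inv := fun v => rfl }
  have hadj : ∀ a b, ((G.comap Subtype.val).induce ((univ : Finset ↥A) : Set ↥A)).Adj a b ↔ (G.induce ((A : Finset V) : Set V)).Adj (e a) (e b) :=
    fun a b => Iff.rfl
  have hcol : (fun w : ↥((univ : Finset ↥A) : Set ↥A) => (c ∘ Subtype.val) (w : ↥A)) = (fun v : ↥((A : Finset V) : Set V) => c (v : V)) ∘ e :=
    funext fun _ => rfl
  rw [hcol, ocrIter_equiv e hadj, card_univ, Fintype.card_coe]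
  rfl

/-- The same as an equality of colourings of the window type. -/
theorem refineIn_comap_subtype_eq (A : Finset V) (c : V → ℕ) :
    refineIn (G.comap Subtype.val) (univ : Finset ↥A) (c ∘ Subtype.val) = refineIn G A c ∘ Subtype.val :=
  funext fun u => refineIn_comap_subtype G A c u

end BranchSum

end Summit.PneNP.PneNP.Theorems
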